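import Summits.NavierStokesRegularity.NavierStokesRegularity.Theorems.TypeITraceScarL3.Negative.StubCFalseWithoutNS
import HarnessLib

/-!
# Stub QA of the registered skeleton v3 for crux `TypeITraceScarL3` (stmt-NavierStokesRegularity-18385) is
# FALSE without its Navier–Stokes clause: the single bump is quiet on a shell of every ratio

Negative-lane lemma of the disprover seat `cdisprove-stmt-NavierStokesRegularity-18385` (`--supports` the
item; crux work file `Cruxes/TypeITraceScarL3/Disproof.lean`, §(ii-b)); part 4 of the kinematic-witness series
(`StubCSpreadWitness`, `StubCSpreadWitnessTypeI`, `StubCFalseWithoutNS`).  The registered skeleton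
`R26-line-annulus-dichotomy.lean` (sha16 a0af4d6cb8b072dd) proves Stub C from two shell stubs; its Stub QA
`stub_no_quietShellExtinctApex` says: for every class `(M, D₀, C)` there is a ratio `A₀ > 1` such that a package
(sw)(G)(I)(D)(R)(T) which is essentially bounded on ONE shell slab `]−δ,0[ × {R < |y| < A₀R}` is not singular at
the origin.  `exists_kinematic_quietShellExtinctApex`: with (sw) dropped this is FALSE — the tree's single
parabolic bump `V = apexVelocity` (`KinematicApexWitness`), `P = 0`, `G = apexGradient`, has (G), (I) (`𝐈 ≤ M` on
all `Q(a)`, from `typeIBound_apex_lt_top`), (D), (R) with `C = 1`, (T) (`|∫⟨V(s),φ⟩| ≤ 8‖φ‖_∞|B₁|(−s)`), is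
QUIET (indeed zero) on `]−1/16,0[ × {1/2 < |y| < A₀/2}` for EVERY `A₀` (its support is `|y| ≤ 2√(−s)`), and is
backward singular at the origin.  So (sw) is load-bearing outright in Stub QA too; the LOUD stub minus (sw) is
vacuously true (its hypothesis `hQA` minus (sw) is the statement refuted here) and gets no census entry.
WHAT THIS IS NOT: not ¬QA, not a Navier–Stokes statement, not NS regularity (neither proved nor refuted here).
References: D. Albritton, T. Barker, Arch. Ration. Mech. Anal. 232 (2019), §1 [AlbrittonBarker2019]; G. Koch,
N. Nadirashvili, G. Seregin, V. Šverák, Acta Math. 203 (2009), (1.4) [KNSS2009].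
-/

noncomputable section

set_option linter.dupNamespace false

namespace Summit.NavierStokesRegularity.NavierStokesRegularity.Theorems.TypeITraceScarL3.Negative

open MeasureTheory Set Function Filter Topology Metric TopologicalSpace
open Literature.Analysis.FluidPDE Literature.Analysis.FluidPDE.ParabolicBump
open scoped NNReal ENNReal InnerProductSpace RealInnerProductSpace

/-! ### Stub QA minus its Navier–Stokes clause is false: the single bump is quiet on every shell -/

/-- **(G) for the single bump** on every `Q(a)` at the origin. [folklore] -/
theorem apex_hasWeakSpatialGradientOn_cylinder (a : ℝ) :
    HasWeakSpatialGradientOn (parabolicCylinderOpens a (0 : ℝ × EuclideanSpace ℝ (Fin 3)))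
      apexVelocity apexGradient := by
  have hQ : ((parabolicCylinderOpens a (0 : ℝ × EuclideanSpace ℝ (Fin 3)) :
      Opens (ℝ × EuclideanSpace ℝ (Fin 3))) : Set (ℝ × EuclideanSpace ℝ (Fin 3))) ⊆ Iio 0 ×ˢ univ := by
    rw [coe_parabolicCylinderOpens]; exact parabolicCylinder_subset_slab a
  have h := hasWeakSpatialGradientOn_of_contDiffOn (S := Iio 0) isOpen_Iio hQ
    (contDiffOn_apexVelocity (n := 1))
  exact h

/-- **(I) for the single bump**: `𝐈(Q(a)) ≤ M` for all `a`, one `M`. [folklore] -/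
theorem typeIBound_apex_cylinder_le :
    ∃ M : ℝ≥0, ∀ a : ℝ, typeIBound (parabolicCylinder a (0 : ℝ × EuclideanSpace ℝ (Fin 3)))
      apexVelocity 0 apexGradient ≤ M := by
  refine ⟨(typeIBound (Iio (0 : ℝ) ×ˢ (univ : Set (EuclideanSpace ℝ (Fin 3)))) apexVelocity 0
    apexGradient).toNNReal, fun a => ?_⟩
  rw [ENNReal.coe_toNNReal typeIBound_apex_lt_top.ne]
  exact typeIBound_mono (parabolicCylinder_subset_slab a)

/-- `|∫ ⟨V(s), φ⟩| ≤ 8 M_φ |B₁| (−s)` for `s < 0`. [folklore] -/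
theorem abs_integral_inner_apex_le {φ : EuclideanSpace ℝ (Fin 3) → EuclideanSpace ℝ (Fin 3)}
    {Mφ : ℝ} (hMφ : ∀ y, ‖φ y‖ ≤ Mφ) {s : ℝ} (hs : s < 0) :
    |∫ y, ⟪apexVelocity s y, φ y⟫| ≤
      8 * Mφ * (volume (ball (0 : EuclideanSpace ℝ (Fin 3)) 1)).toReal * (-s) := by
  have hM0 : 0 ≤ Mφ := (norm_nonneg _).trans (hMφ 0)
  have hns : 0 < -s := by linarith
  have hσ : 0 < Real.sqrt (-s) := Real.sqrt_pos.2 hns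
  set V₁r : ℝ := (volume (ball (0 : EuclideanSpace ℝ (Fin 3)) 1)).toReal with hV₁r
  set g : EuclideanSpace ℝ (Fin 3) → ℝ := fun y => Mφ * (1 / Real.sqrt (-s)) *
    (ball (0 : EuclideanSpace ℝ (Fin 3)) (2 * Real.sqrt (-s))).indicator (fun _ => (1 : ℝ)) y with hg
  have hbound : ∀ y, ‖⟪apexVelocity s y, φ y⟫‖ ≤ g y := by
    intro y
    rw [Real.norm_eq_abs]
    calc |⟪apexVelocity s y, φ y⟫| ≤ ‖apexVelocity s y‖ * ‖φ y‖ := abs_real_inner_le_norm _ _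
      _ ≤ (1 / Real.sqrt (-s) *
            (ball (0 : EuclideanSpace ℝ (Fin 3)) (2 * Real.sqrt (-s))).indicator (fun _ => (1 : ℝ)) y) *
            Mφ :=
          mul_le_mul (norm_apexVelocity_le_indicator hs y) (hMφ y) (norm_nonneg _)
            (mul_nonneg (by positivity) (indicator_nonneg (fun _ _ => zero_le_one) _))
      _ = g y := by rw [hg]; ring
  have hint : Integrable g volume := (integrable_ball_indicator_one _ _).const_mul _
  have h1 : ‖∫ y, ⟪apexVelocity s y, φ y⟫‖ ≤ ∫ y, g y :=
    norm_integral_le_of_norm_le hint (Eventually.of_forall hbound)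
  rw [Real.norm_eq_abs] at h1
  refine h1.trans (le_of_eq ?_)
  rw [hg, integral_const_mul, integral_ball_indicator_one,
    volume_ball_toReal (0 : EuclideanSpace ℝ (Fin 3)) (by positivity : (0 : ℝ) < 2 * Real.sqrt (-s)),
    ← hV₁r, two_sqrt_cube hs]
  field_simp

/-- **(T) for the single bump**: weakly null top. [folklore] -/
theorem apex_nullTop (φ : EuclideanSpace ℝ (Fin 3) → EuclideanSpace ℝ (Fin 3))
    (hφ : ContDiff ℝ (⊤ : ℕ∞) φ) (hφc : HasCompactSupport φ) (ε : ℝ) (hε : 0 < ε) :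
    ∃ s₀ : ℝ, s₀ < 0 ∧ ∀ᵐ s ∂(volume.restrict (Ioo s₀ 0)),
      |∫ y, ⟪apexVelocity s y, φ y⟫| ≤ ε := by
  obtain ⟨Mφ, hMφ⟩ := hφ.continuous.bounded_above_of_compact_support hφc
  have hM0 : 0 ≤ Mφ := (norm_nonneg _).trans (hMφ 0)
  set V₁r : ℝ := (volume (ball (0 : EuclideanSpace ℝ (Fin 3)) 1)).toReal with hV₁r
  have hV0 : 0 ≤ V₁r := ENNReal.toReal_nonneg
  have hden : 0 < 8 * Mφ * V₁r + 1 := by positivity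
  refine ⟨-(ε / (8 * Mφ * V₁r + 1)), by rw [neg_lt_zero]; positivity, ?_⟩
  refine (ae_restrict_iff' measurableSet_Ioo).2 (Eventually.of_forall fun s hs => ?_)
  refine (abs_integral_inner_apex_le hMφ hs.2).trans ?_
  rw [← hV₁r]
  have h1 : -s < ε / (8 * Mφ * V₁r + 1) := by linarith [hs.1]
  calc 8 * Mφ * V₁r * (-s) ≤ 8 * Mφ * V₁r * (ε / (8 * Mφ * V₁r + 1)) := by
        gcongr
    _ = ε * (8 * Mφ * V₁r / (8 * Mφ * V₁r + 1)) := by ring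
    _ ≤ ε * 1 := by
        gcongr
        rw [div_le_one hden]; linarith
    _ = ε := mul_one ε

/-- **Quiet shells for the single bump**: on `]−1/16, 0[ × {1/2 < ‖y‖ < A₀/2}` the bump vanishes, for
every ratio `A₀`. [folklore] -/
theorem apex_quietShell (A₀ : ℝ) :
    ∃ δ : ℝ, 0 < δ ∧ ∃ R : ℝ, 0 < R ∧ ∃ K : ℝ,
      ∀ᵐ z ∂(volume.restrict
        (Ioo (-δ) 0 ×ˢ {y : EuclideanSpace ℝ (Fin 3) | R < ‖y‖ ∧ ‖y‖ < A₀ * R})),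
          ‖apexVelocity z.1 z.2‖ ≤ K := by
  have hS : MeasurableSet {y : EuclideanSpace ℝ (Fin 3) | (1 / 2 : ℝ) < ‖y‖ ∧ ‖y‖ < A₀ * (1 / 2)} :=
    (measurableSet_lt measurable_const measurable_norm).inter
      (measurableSet_lt measurable_norm measurable_const)
  refine ⟨1 / 16, by norm_num, 1 / 2, by norm_num, 0, ?_⟩
  refine (ae_restrict_iff' (measurableSet_Ioo.prod hS)).2 (Eventually.of_forall ?_)
  rintro ⟨t, y⟩ ⟨⟨ht1, ht2⟩, hy1, -⟩
  have hst : Real.sqrt (-t) < 1 / 4 := by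
    rw [show (1 / 4 : ℝ) = Real.sqrt (1 / 16) by
      rw [show (1 / 16 : ℝ) = (1 / 4) ^ 2 by norm_num, Real.sqrt_sq (by norm_num)]]
    exact Real.sqrt_lt_sqrt (by linarith) (by linarith)
  have hy : 2 * Real.sqrt (-t) ≤ ‖y‖ := by
    have : (1 / 2 : ℝ) < ‖y‖ := hy1
    linarith
  show ‖apexVelocity t y‖ ≤ 0
  rw [apexVelocity_eq_zero_of ht2 hy, norm_zero]

/-- **Stub QA `stub_no_quietShellExtinctApex` (skeleton v3 `R26-line-annulus-dichotomy`, sha16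
a0af4d6cb8b072dd) minus its Navier–Stokes clause is FALSE**: with `M` from `typeIBound_apex_cylinder_le`,
`D₀ = 0`, `C = 1`, for EVERY ratio `A₀` the single bump `V = apexVelocity`, `P = 0`, `G = apexGradient`
satisfies (G), (I), (D), (R), (T), has a quiet shell of ratio `A₀` (`apex_quietShell`) and a backward-singular
origin (`apex_isBackwardSingularPoint`).  So QA is genuinely dynamical as well. [folklore; frame of
AlbrittonBarker2019 §1] -/
theorem exists_kinematic_quietShellExtinctApex :
    ∃ (M D₀ : ℝ≥0) (C : ℝ), ∀ A₀ : ℝ,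
      ∃ (U : ℝ → EuclideanSpace ℝ (Fin 3) → EuclideanSpace ℝ (Fin 3))
        (P : ℝ → EuclideanSpace ℝ (Fin 3) → ℝ)
        (G : ℝ → EuclideanSpace ℝ (Fin 3) → EuclideanSpace ℝ (Fin 3) →L[ℝ] EuclideanSpace ℝ (Fin 3)),
      (∀ a : ℝ, 0 < a →
        HasWeakSpatialGradientOn
          (parabolicCylinderOpens a (0 : ℝ × EuclideanSpace ℝ (Fin 3))) U G) ∧
      (∀ a : ℝ, 0 < a →
        typeIBound (parabolicCylinder a (0 : ℝ × EuclideanSpace ℝ (Fin 3))) U P G ≤ M) ∧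
      (∀ z₀ : ℝ × EuclideanSpace ℝ (Fin 3), z₀.1 ≤ 0 →
        ∀ r : ℝ, 0 < r → cknD r z₀ P ≤ D₀) ∧
      (∀ s : ℝ, s < 0 →
        ∀ᵐ y : EuclideanSpace ℝ (Fin 3), ‖U s y‖ ≤ C / Real.sqrt (-s)) ∧
      (∀ φ : EuclideanSpace ℝ (Fin 3) → EuclideanSpace ℝ (Fin 3),
        ContDiff ℝ (⊤ : ℕ∞) φ →
        HasCompactSupport φ → ∀ ε : ℝ, 0 < ε →
        ∃ s₀ : ℝ, s₀ < 0 ∧ ∀ᵐ s ∂(volume.restrict (Ioo s₀ 0)), |∫ y, ⟪U s y, φ y⟫| ≤ ε) ∧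
      (∃ δ : ℝ, 0 < δ ∧ ∃ R : ℝ, 0 < R ∧ ∃ K : ℝ,
        ∀ᵐ z ∂(volume.restrict
          (Ioo (-δ) 0 ×ˢ {y : EuclideanSpace ℝ (Fin 3) | R < ‖y‖ ∧ ‖y‖ < A₀ * R})),
            ‖U z.1 z.2‖ ≤ K) ∧
      IsBackwardSingularPoint U (0 : ℝ × EuclideanSpace ℝ (Fin 3)) := by
  obtain ⟨M, hM⟩ := typeIBound_apex_cylinder_le
  refine ⟨M, 0, 1, fun A₀ => ⟨apexVelocity, 0, apexGradient, fun a _ => apex_hasWeakSpatialGradientOn_cylinder a,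
    fun a _ => hM a, fun z₀ _ r _ => by rw [cknD_zero]; exact bot_le, fun s _ => ae_of_all _ fun y => norm_apexVelocity_le s y,
    apex_nullTop, apex_quietShell A₀, apex_isBackwardSingularPoint⟩⟩

end Summit.NavierStokesRegularity.NavierStokesRegularity.Theorems.TypeITraceScarL3.Negative

end
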